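import Mathlib

/-!
# Refutation of the pointwise monotone-flag conjecture `TFC(8)` at `n = 5` and `n = 6`  [folklore]

Repair cell b2b-imbrie, seat 2, K-line (DENSITY-XY PS G.61.9).  For an `n`-point probability measure
`μ = ∑ wᵢ δ_{xᵢ}` (distinct atoms, positive weights, `∑ wᵢ = 1`) put
`P(S) = ∏_{i∈S} wᵢ ∏_{i<j∈S} (xᵢ-xⱼ)²` and `D_k = ∑_{|S|=k} P(S)`; by the Heine / Cauchy–Binet identity
`D_k = det (m_{i+j})_{i,j<k}` (Hankel moment determinants) and `b_k² = D_{k-1}D_{k+1}/D_k²`, the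
condition `D_{k-1} D_{k+1} ≤ D_k²` (`1 ≤ k < n`) says exactly that the Jacobi matrix of `μ` has
off-diagonal entries `0 < b_k ≤ 1`, i.e. `μ ∈ B̄_n` (`inBbar`).  A FLAG is an ordering `σ` of the atoms
with levels `û_k = w_{σ_k} ∏_{j<k} (x_{σ_k} - x_{σ_j})²` (`flagLevel`); it is 8-tempered if
`û_{k+1} ≤ 8 û_k` for all `k` (`tempered8`).  The cell's pointwise statement TFC(8) (= MFC) reads: every
`μ ∈ B̄_n` has an 8-tempered flag (`TFC8`; a theorem for `n = 3`, `MonotoneFlagThree`; FALSE for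
`n = 5, 6` by the present file, and for all `n ≥ 7` by the outlier family of DENSITY-XY PS G.61.9).

* `tfc8_fails_five` : `¬ TFC8 5` — the rational measure with atoms
  `(-71/50, 0, 1419/1000, 71/50, 1421/1000)` and weights `(1/8, 1/2, 1/8, 1/8, 1/8)` lies in `B̄₅` and
  every one of its 120 flags has a step with `û_{k+1} > 8 û_k` (certificate checked by `decide`).
* `tfc8_fails_six` : `¬ TFC8 6` — a six-atom rational measure (a light far atom split four ways).

Everything is exact rational arithmetic verified by the kernel.  Nothing here concerns CONJECTURE K,
the averaged flag-sum statement F♮, the budget statements, LLA or the interacting chain.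
-/

namespace Literature.MathematicalPhysics.QuantumLattice.Imbrie2016

open Finset

/-- [folklore] `P(S) = ∏_{i∈S} wᵢ · ∏_{i<j∈S} (xᵢ - xⱼ)²`. -/
def subsetWeight {n : ℕ} (x w : Fin n → ℚ) (S : Finset (Fin n)) : ℚ :=
  (∏ i ∈ S, w i) * ∏ i ∈ S, ∏ j ∈ S, (if i < j then (x i - x j) ^ 2 else 1)

/-- [folklore] `D_k = ∑_{|S| = k} P(S)` (the `k × k` Hankel moment determinant). -/
def hankelD {n : ℕ} (x w : Fin n → ℚ) (k : ℕ) : ℚ :=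
  ∑ S ∈ (univ : Finset (Fin n)).powersetCard k, subsetWeight x w S

/-- [folklore] `μ ∈ B̄_n`: a probability measure on `n` distinct atoms whose Jacobi coefficients satisfy
`b_k² = D_{k-1} D_{k+1} / D_k² ≤ 1` for `1 ≤ k < n`. -/
def inBbar {n : ℕ} (x w : Fin n → ℚ) : Prop :=
  (∑ i, w i) = 1 ∧ (∀ i, 0 < w i) ∧ Function.Injective x ∧
    ∀ k : ℕ, 1 ≤ k → k < n → hankelD x w (k - 1) * hankelD x w (k + 1) ≤ hankelD x w k ^ 2

/-- [folklore] The `k`-th level of the flag `σ`: `û_k = w_{σ k} ∏_{j<k} (x_{σ k} - x_{σ j})²`. -/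
def flagLevel {n : ℕ} (x w : Fin n → ℚ) (σ : Fin n → Fin n) (k : Fin n) : ℚ :=
  w (σ k) * ∏ j ∈ univ.filter (· < k), (x (σ k) - x (σ j)) ^ 2

/-- [folklore] The flag `σ` is 8-tempered: `û_{k+1} ≤ 8 û_k` for every `k`. -/
def tempered8 {n : ℕ} (x w : Fin (n + 1) → ℚ) (σ : Fin (n + 1) → Fin (n + 1)) : Prop :=
  ∀ k : Fin n, flagLevel x w σ k.succ ≤ 8 * flagLevel x w σ k.castSucc

/-- [folklore] The statement TFC(8) at size `n + 1`: every measure in `B̄_{n+1}` has an 8-tempered flag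
(true for `n + 1 ≤ 3`, refuted below for `n + 1 = 5, 6`). -/
def TFC8 (n : ℕ) : Prop :=
  ∀ x w : Fin (n + 1) → ℚ, inBbar x w → ∃ σ : Equiv.Perm (Fin (n + 1)), tempered8 x w σ

/-- [folklore] Atoms of the five-point certificate. -/
def cert5x : Fin 5 → ℚ := ![-71/50, 0, 1419/1000, 71/50, 1421/1000]

/-- [folklore] Weights of the five-point certificate. -/
def cert5w : Fin 5 → ℚ := ![1/8, 1/2, 1/8, 1/8, 1/8]

/-- [folklore] The five-point certificate lies in `B̄₅` (`b² ≈ (0.882, 0.988, 4.7e-6, 3.3e-7)`). -/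
theorem cert5_inBbar : inBbar cert5x cert5w := by
  refine ⟨by decide +kernel, by decide +kernel, by decide +kernel, ?_⟩
  intro k hk hk5
  interval_cases k <;> decide +kernel

/-- [folklore] Every flag of the five-point certificate has a step with `û_{k+1} > 8 û_k`
(new here: repair cell b2b-imbrie, seat 2, DENSITY-XY PS G.61.9, 2026-08-19 — a claimed refutation
certificate under adjudication, not a published result). -/
theorem cert5_flags : ∀ a b c d e : Fin 5, a ≠ b → a ≠ c → a ≠ d → a ≠ e → b ≠ c → b ≠ d →
    b ≠ e → c ≠ d → c ≠ e → d ≠ e →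
    ∃ k : Fin 4, 8 * flagLevel cert5x cert5w ![a, b, c, d, e] k.castSucc <
      flagLevel cert5x cert5w ![a, b, c, d, e] k.succ := by
  decide +kernel

/-- [folklore] TFC(8) (= the monotone flag conjecture MFC) FAILS at `n = 5`
(new here: repair cell b2b-imbrie, seat 2, DENSITY-XY PS G.61.9, 2026-08-19 — a claimed refutation
certificate under adjudication, not a published result). -/
theorem tfc8_fails_five : ¬ TFC8 4 := by
  intro h
  obtain ⟨σ, hσ⟩ := h cert5x cert5w cert5_inBbar
  have hfun : (σ : Fin 5 → Fin 5) = ![σ 0, σ 1, σ 2, σ 3, σ 4] := by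
    funext i; fin_cases i <;> rfl
  have hne : ∀ i j : Fin 5, i ≠ j → σ i ≠ σ j := fun i j hij => σ.injective.ne hij
  obtain ⟨k, hk⟩ := cert5_flags (σ 0) (σ 1) (σ 2) (σ 3) (σ 4) (hne 0 1 (by decide))
    (hne 0 2 (by decide)) (hne 0 3 (by decide)) (hne 0 4 (by decide)) (hne 1 2 (by decide))
    (hne 1 3 (by decide)) (hne 1 4 (by decide)) (hne 2 3 (by decide)) (hne 2 4 (by decide))
    (hne 3 4 (by decide))
  have := hσ k
  rw [hfun] at this
  exact absurd hk (not_lt.mpr this)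

/-- [folklore] Atoms of the six-point certificate (a light far atom split four ways; positions ×0.99). -/
def cert6x : Fin 6 → ℚ :=
  ![-23274603/10000000, -23273603/10000000, -23272603/10000000, -23271603/10000000,
    3700719/5000000, 2672901/2500000]

/-- [folklore] Weights of the six-point certificate. -/
def cert6w : Fin 6 → ℚ := ![11/2000, 11/2000, 11/2000, 11/2000, 587/1000, 391/1000]

/-- [folklore] The six-point certificate lies in `B̄₆` (`b² ≈ (0.246, 0.984, 1.2e-7, 8e-9, 4.5e-9)`). -/
theorem cert6_inBbar : inBbar cert6x cert6w := by
  refine ⟨by decide +kernel, by decide +kernel, by decide +kernel, ?_⟩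
  intro k hk hk6
  interval_cases k <;> decide +kernel

/-- [folklore] Every flag of the six-point certificate has a step with `û_{k+1} > 8 û_k`
(new here: repair cell b2b-imbrie, seat 2, DENSITY-XY PS G.61.9, 2026-08-19 — a claimed refutation
certificate under adjudication, not a published result). -/
theorem cert6_flags : ∀ a b c d e f : Fin 6, a ≠ b → a ≠ c → a ≠ d → a ≠ e → a ≠ f → b ≠ c →
    b ≠ d → b ≠ e → b ≠ f → c ≠ d → c ≠ e → c ≠ f → d ≠ e → d ≠ f → e ≠ f →
    ∃ k : Fin 5, 8 * flagLevel cert6x cert6w ![a, b, c, d, e, f] k.castSucc <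
      flagLevel cert6x cert6w ![a, b, c, d, e, f] k.succ := by
  decide +kernel

/-- [folklore] TFC(8) (= MFC) FAILS at `n = 6`
(new here: repair cell b2b-imbrie, seat 2, DENSITY-XY PS G.61.9, 2026-08-19 — a claimed refutation
certificate under adjudication, not a published result). -/
theorem tfc8_fails_six : ¬ TFC8 5 := by
  intro h
  obtain ⟨σ, hσ⟩ := h cert6x cert6w cert6_inBbar
  have hfun : (σ : Fin 6 → Fin 6) = ![σ 0, σ 1, σ 2, σ 3, σ 4, σ 5] := by
    funext i; fin_cases i <;> rfl
  have hne : ∀ i j : Fin 6, i ≠ j → σ i ≠ σ j := fun i j hij => σ.injective.ne hij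
  obtain ⟨k, hk⟩ := cert6_flags (σ 0) (σ 1) (σ 2) (σ 3) (σ 4) (σ 5) (hne 0 1 (by decide))
    (hne 0 2 (by decide)) (hne 0 3 (by decide)) (hne 0 4 (by decide)) (hne 0 5 (by decide))
    (hne 1 2 (by decide)) (hne 1 3 (by decide)) (hne 1 4 (by decide)) (hne 1 5 (by decide))
    (hne 2 3 (by decide)) (hne 2 4 (by decide)) (hne 2 5 (by decide)) (hne 3 4 (by decide))
    (hne 3 5 (by decide)) (hne 4 5 (by decide))
  have := hσ k
  rw [hfun] at this
  exact absurd hk (not_lt.mpr this)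

end Literature.MathematicalPhysics.QuantumLattice.Imbrie2016
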